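import Summits.ResolutionOfSingularities.ResolutionOfSingularities.Theorems.FrobeniusLadderFInjectiveMacaulayficationFHalfRowOfTwoStoreysLocal
import HarnessLib

/-!
# (W-TD) two-storey glue: the COMPOSABLE merge step (towers of any height) and the SPLIT form of the FULL-ness input (over the centre / off the centre)
# (crux `FInjectiveMacaulayfication` stmt-ResolutionOfSingularities-15315, chain w45a; res-L1-w45a-plan-1 RULING R21.23 (2)(3) «row #8 route (W1): hfull split (α)(β)(γ); does ✓p658557
# compose for a third storey (β′)? — say»; seat res-L1-w45a-stub-1 g12)

[OURS · L1 W4.5a] Support file (`--supports stmt-ResolutionOfSingularities-15315 --as helper`); def-free; UNCONDITIONAL; no named fact. AI-written (AI review weaker than expert review).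

* ★ `exists_mul_of_twoStoreys` — THE MERGE STEP, exported: storey 1 `π₁ = Bl_{Jτ·JK}` and storey 2 `π₂ = Bl_{J′} X₁` with `Jτ, JK, π₁(Supp J′)` meeting the generizations of `x`
  only in `x` ⇒ `π₂ ≫ π₁ = Bl_{Jτ·JK₂}` for some `JK₂` with the SAME support property and `Jτ·JK₂ ≠ ⊥`. Hence ✓ p658557 COMPOSES: a tower of ANY height with all higher centres
  over `x` collapses storey by storey to the one-storey lemma (answer to R21.23 (3)(β′): YES).
* ★ `fHalfConclusion_of_twoStoreys_split` — ✓ p658557 with its `hfull` input SPLIT: (α/β) FULL of `X₂` at the points lying over `Supp J′` (to be discharged chart by chart: the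
  class row on the storey-2 chart, toric regularity at the points at infinity, …) and (γ) FULL of `X₁` at the points over a generization of `x` OFF `Supp J′` (storey-1
  certificates), the transport off the centre (`isIso_compl`) done here once.
[cite: StacksProject, Tag 080B] [cite: Temkin2008, Lemma 2.1.4]
-/

-- single-problem summit: the doubled namespace component is forced
set_option linter.dupNamespace false

noncomputable section

namespace Summit.ResolutionOfSingularities.ResolutionOfSingularities.Theorems.FInjectiveMacaulayfication.FHalfRowOfTwoStoreys

open CategoryTheory CategoryTheory.Limits AlgebraicGeometry TopologicalSpace IsLocalRing
open Literature.AlgebraicGeometry.Resolution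
open Summit.ResolutionOfSingularities.ResolutionOfSingularities.Theorems.FInjectiveMacaulayfication
open SliceableCentre GermOfGlobalBlowup

/-- ★ **The merge step of the two-storey glue, exported (towers compose).** [cite: StacksProject, Tag 080B] [cite: Temkin2008, Lemma 2.1.4] -/
theorem exists_mul_of_twoStoreys {X X₁ X₂ : Scheme.{0}} [IsIntegral X] [IsNoetherian X] (x : X)
    {π₁ : X₁ ⟶ X} {Jτ JK : X.IdealSheafData} (hπ₁ : IsBlowup π₁ (Jτ * JK)) (hJ : Jτ * JK ≠ ⊥)
    (hsuppτ : ∀ y ∈ (Jτ.support : Set X), y ⤳ x → y = x) (hsuppK : ∀ y ∈ (JK.support : Set X), y ⤳ x → y = x)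
    {π₂ : X₂ ⟶ X₁} {J' : X₁.IdealSheafData} (hπ₂ : IsBlowup π₂ J') (hJ' : J' ≠ ⊥)
    (hsupp' : ∀ y₁ ∈ (J'.support : Set X₁), π₁.base y₁ ⤳ x → π₁.base y₁ = x) :
    ∃ JK₂ : X.IdealSheafData, IsBlowup (π₂ ≫ π₁) (Jτ * JK₂) ∧ Jτ * JK₂ ≠ ⊥ ∧ ∀ y ∈ (JK₂.support : Set X), y ⤳ x → y = x := by
  obtain ⟨d, R, hR⟩ := hπ₁.exists_comap_eq_mul_pow J'
  have hπ₂' : IsBlowup π₂ (R.comap π₁) := by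
    rw [hR]
    exact hπ₂.mul_of_isEffectiveCartier (hπ₁.isEffectiveCartier.pow d)
  have hcomp : IsBlowup (π₂ ≫ π₁) (Jτ * (JK * R)) := by
    rw [← mul_assoc]
    exact hπ₁.comp hπ₂'
  haveI : IsIntegral X₁ := hπ₁.isIntegral hJ
  haveI : IsIntegral X₂ := hπ₂.isIntegral hJ'
  have hQ : Jτ * (JK * R) ≠ ⊥ := by
    intro h0
    rw [h0] at hcomp
    haveI := LocalBlowupDesingularizationDimThree.isEmpty_of_isBlowup_bot hcomp
    obtain ⟨t⟩ := (inferInstance : Nonempty ↥X₂)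
    exact IsEmpty.false t
  have hsuppP : ∀ y ∈ ((Jτ * JK).support : Set X), y ⤳ x → y = x := by
    intro y hy hyx
    rw [Scheme.IdealSheafData.support_mul] at hy
    rcases hy with hy | hy
    · exact hsuppτ y hy hyx
    · exact hsuppK y hy hyx
  have hsuppR := support_generization_of_comap_eq x hπ₁ hsuppP hsupp' hR
  refine ⟨JK * R, hcomp, hQ, fun y hy hyx => ?_⟩
  rw [Scheme.IdealSheafData.support_mul] at hy
  rcases hy with hy | hy
  · exact hsuppK y hy hyx
  · exact hsuppR y hy hyx

/-- ★ **Two-storey glue, SPLIT form of the FULL-ness input**: FULL of `X₂` at the points over `Supp J′` (α/β) and FULL of `X₁` over the generizations of `x` off `Supp J′` (γ).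
[cite: StacksProject, Tag 080B] [cite: GortzWedhorn2020, Prop. 13.91] -/
theorem fHalfConclusion_of_twoStoreys_split (p : ℕ) {X X₁ X₂ : Scheme.{0}} [IsIntegral X] [IsNoetherian X] (x : X)
    {π₁ : X₁ ⟶ X} {Jτ JK : X.IdealSheafData} (hπ₁ : IsBlowup π₁ (Jτ * JK)) (hJ : Jτ * JK ≠ ⊥)
    (hsuppτ : ∀ y ∈ (Jτ.support : Set X), y ⤳ x → y = x) (hsuppK : ∀ y ∈ (JK.support : Set X), y ⤳ x → y = x)
    {π₂ : X₂ ⟶ X₁} {J' : X₁.IdealSheafData} (hπ₂ : IsBlowup π₂ J') (hJ' : J' ≠ ⊥)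
    (hsupp' : ∀ y₁ ∈ (J'.support : Set X₁), π₁.base y₁ ⤳ x → π₁.base y₁ = x)
    (hα : ∀ x₂ : X₂, π₂.base x₂ ∈ (J'.support : Set X₁) → FullCl p (X₂.presheaf.stalk x₂))
    (hγ : ∀ x₁ : X₁, x₁ ∉ (J'.support : Set X₁) → π₁.base x₁ ⤳ x → FullCl p (X₁.presheaf.stalk x₁)) :
    ∀ (S' : Scheme.{0}) (g : S' ⟶ Spec (X.presheaf.stalk x)), IsBlowup g (Jτ.comap (X.fromSpecStalk x)) →
      ∃ 𝓚 : S'.IdealSheafData, 𝓚 ≠ ⊥ ∧ (∀ s ∈ (𝓚.support : Set S'), g.base s = closedPoint (X.presheaf.stalk x)) ∧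
        ∀ (S'' : Scheme.{0}) (π : S'' ⟶ S'), IsBlowup π 𝓚 → ∀ s : S'', FullCl p (S''.presheaf.stalk s) := by
  refine fHalfConclusion_of_twoStoreys p x hπ₁ hJ hsuppτ hsuppK hπ₂ hJ' hsupp' fun x₂ hx₂ => ?_
  by_cases hmem : π₂.base x₂ ∈ (J'.support : Set X₁)
  · exact hα x₂ hmem
  · haveI : IsIso (π₂ ∣_ (⟨(J'.support : Set X₁)ᶜ, J'.support.isClosed.isOpen_compl⟩ : X₁.Opens)) := hπ₂.isIso_compl
    haveI := isIso_stalkMap_of_isIso_morphismRestrict π₂ (⟨(J'.support : Set X₁)ᶜ, J'.support.isClosed.isOpen_compl⟩ : X₁.Opens) x₂ hmem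
    refine FTemkinClosedPoints.fullCl_of_isIso_stalkMap' p π₂ x₂ (hγ _ hmem ?_)
    have : (π₂ ≫ π₁).base x₂ = π₁.base (π₂.base x₂) := by rw [Scheme.Hom.comp_base]; rfl
    rw [this] at hx₂
    exact hx₂

end Summit.ResolutionOfSingularities.ResolutionOfSingularities.Theorems.FInjectiveMacaulayfication.FHalfRowOfTwoStoreys

end
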